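import Mathlib
import HarnessLib
import Literature.Geometry.DiscreteGeometry.BondGraph
import Literature.Geometry.DiscreteGeometry.KissingPatterns
import Summits.AtomisticToContinuum.Crystallization.Theorems.PricedLinkCensusSoftLayerPropagationBasics
import Summits.AtomisticToContinuum.Crystallization.Theorems.PricedLinkCensusSoftLayerPropagationStubDevelopReduction
import Summits.AtomisticToContinuum.Crystallization.Theorems.PricedLinkCensusSoftLayerPropagationStubDevelopHO
import Summits.AtomisticToContinuum.Crystallization.Theorems.PricedLinkCensusSoftLayerPropagationStubDevelopHXFcc
import Summits.AtomisticToContinuum.Crystallization.Theorems.PricedLinkCensusSoftLayerPropagationStubDevelopHXHcp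
import Summits.AtomisticToContinuum.Crystallization.Theorems.PricedLinkCensusSoftLayerPropagationDevelopRestReach

/-!
# The remainder of the development, reduced to the metric ordered-caps lemma
# (crux `SoftLayerPropagation`, line `Sketch`, stub `develop_rest`, registered sub-goal `develop_of_orderedCaps`)

Route `PricedLinkCensus`, crux `SoftLayerPropagation` (stmt-AtomisticToContinuum-14233), line
`Sketch`.  Helper file for the registered stub `develop_rest` (the remainder of the exact shadow
development after `develop_HO`, `develop_HX_fcc`, `develop_HX_hcp`): the PLUMBING around the landed
engine `Theorems.develop_reduction`, leaving exactly one local metric fact open — the ORDERED CAPS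
lemma in metric form (`H1R`, the first antecedent of `develop_rest_of_orderedCaps` and the only
antecedent of the registered `develop_of_orderedCaps`):

  at a site `u` with `dist (y i) (y u) + (8/3) nn_u ≤ 8 nn_i` (so that everything within `(8/3) nn_u`
  of `u` is charge-free and charted), if `u ~ t ~ k`, `u ≁ k`, `u ≠ k`, and, measured from `y i`,
  `k` is not farther than `u` by more than `(11/200) nn_u` and `t` is not nearer than `u` by more
  than `(3/100) nn_u`, then some bond-neighbour `c` of `u`, nearer to `y i` than `u` by MORE than
  `(3/100) nn_u`, is bonded to `t` or to `k`.

(Numerics, this worker: on ideal FCC/HCP/mixed Barlow clusters — 8 Hägg words of the five layers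
about `u`, 672 combinatorial types `(t, k)`, observer `y i` in every direction at every distance
`0.95 ≤ r ≤ 6.6` — the best candidate among the ring of `{u, t}` and the common neighbours of
`{u, k}` is nearer than `u` by `≥ 0.336 nn`; with the premises relaxed by `ε` the margin is
`0.30 / 0.29 / 0.24 / 0.21 / 0.17` at `ε = 0.05 / 0.10 / 0.15 / 0.20 / 0.30`; the square-diagonal
types need the far apex of the coned square, the others only the ring; the antipodal types are
vacuous.  So `H1R` holds as soon as the cluster `{u, t, k, candidates}` is known to `≲ 0.17 nn`
per site up to a rigid motion; the landed cell lemmas give `0.13–0.20 nn` per octahedron identity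
at the edge window `(1+η)²–(1+η)³` and the charts give `nn/4`.)

Given `H1R`, the stub follows from `develop_reduction` (`develop_rest_of_orderedCaps`; the registered
`develop_of_orderedCaps` is the same with the three landed local lemmas `develop_HO`,
`develop_HX_fcc`, `develop_HX_hcp` of the tree plugged in, i.e. `H1R →` the conclusion of
`develop_rest`) with

* the charts `Pc, Ac, mc` of the hypothesis `HO` (= `develop_HO`, gauge-fixed, with handedness);
* the PENALISED RADIAL POTENTIAL `f v = dist (y i) (y v) + (8/3)·max 0 (nn_v − (53/50) nn_i)` and
  `R₁ = (129/25) nn_i`, `R₂ = 8 nn_i`: on the graph `5`-ball `nn_v ≤ (101/100)⁵ nn_i < (53/50) nn_i`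
  and `dist ≤ 5.1521 nn_i` (`developRest_reach_five`), so `f = dist ≤ R₁` there (`Hcover`); conversely
  `f v ≤ R₁` forces `dist (y i) (y v) + (8/3) nn_v ≤ (599/75) nn_i < 8 nn_i`, which is the scope
  needed by `H1R` and by the two no-merge hypotheses (`5/2 · nn_x`-balls inside the charted
  `8 nn_i`-ball) and gives `hnbr` (a neighbour of `{f ≤ R₁}` has `f ≤ 8 nn_i`) WITHOUT any scale
  coherence lemma; the penalty changes by at most `(8/3)·η·nn` across a bond, which is where the
  slacks `11/200`, `3/100`, `3/100` of `H1R` come from;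
* `HX` at `x` with `f x ≤ R₁`: case on `Pc x` and apply `develop_HX_fcc` / `develop_HX_hcp` (the
  second and third antecedents) to the chart `(Ac x, mc x)`.

All `[folklore]`; no new definitions.
-/

noncomputable section

namespace Summit.AtomisticToContinuum.Crystallization.Theorems

open Literature.Geometry.DiscreteGeometry

/-! ### The reduction -/

/-- **`develop_rest_of_orderedCaps`**: the registered stub
`develop_rest` (all four of its antecedent-conclusion blocks, verbatim) from ONE further local
hypothesis, the metric ordered-caps lemma `H1R` (first antecedent; see the module docstring), by
`Theorems.develop_reduction` run with the gauge-fixed charts of `HO`, the penalised radial potential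
`f v = dist (y i) (y v) + (8/3) max 0 (nn_v − (53/50) nn_i)`, `R₁ = (129/25) nn_i`, `R₂ = 8 nn_i`.
[folklore] -/
theorem develop_rest_of_orderedCaps :
    (∀ η : ℝ, 0 < η → η ≤ 1 / 100 → ∀ (N : ℕ) (y : Fin N → EuclideanSpace ℝ (Fin 3)) (i : Fin N), 0 < Literature.Geometry.DiscreteGeometry.nearestDist y i → (∀ j : Fin N, dist (y i) (y j) ≤ 8 *
    Literature.Geometry.DiscreteGeometry.nearestDist y i → Literature.Geometry.DiscreteGeometry.IsChargeFree η y j) → (∀ j : Fin N, dist (y i) (y j) ≤ 8 *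
    Literature.Geometry.DiscreteGeometry.nearestDist y i → ∃ (P : Finset (EuclideanSpace ℝ (Fin 3))) (A : EuclideanSpace ℝ (Fin 3) →ₗᵢ[ℝ] EuclideanSpace ℝ (Fin 3)) (m : EuclideanSpace ℝ (Fin 3) → Fin
    N), (P = Literature.Geometry.DiscreteGeometry.fccKissingPattern ∨ P = Literature.Geometry.DiscreteGeometry.hcpKissingPattern) ∧ (∀ p ∈ P, (Literature.Geometry.DiscreteGeometry.bondGraph η y).Adj j
    (m p) ∧ dist (y (m p)) (y j + Literature.Geometry.DiscreteGeometry.nearestDist y j • A p) ≤ Literature.Geometry.DiscreteGeometry.nearestDist y j / 4) ∧ (∀ p ∈ P, ∀ q ∈ P, m p = m q → p = q) ∧ (∀ p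
    ∈ P, ∀ q ∈ P, ((Literature.Geometry.DiscreteGeometry.bondGraph η y).Adj (m p) (m q) ↔ dist p q = 1)) ∧ (∀ k, (Literature.Geometry.DiscreteGeometry.bondGraph η y).Adj j k → ∃ p ∈ P, m p = k)) → ∀ u
    t k : Fin N, dist (y i) (y u) + 8 / 3 * Literature.Geometry.DiscreteGeometry.nearestDist y u ≤ 8 * Literature.Geometry.DiscreteGeometry.nearestDist y i →
    (Literature.Geometry.DiscreteGeometry.bondGraph η y).Adj u t → (Literature.Geometry.DiscreteGeometry.bondGraph η y).Adj t k → ¬ (Literature.Geometry.DiscreteGeometry.bondGraph η y).Adj u k → u ≠ k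
    → dist (y i) (y k) ≤ dist (y i) (y u) + 11 / 200 * Literature.Geometry.DiscreteGeometry.nearestDist y u → dist (y i) (y u) ≤ dist (y i) (y t) + 3 / 100 *
    Literature.Geometry.DiscreteGeometry.nearestDist y u → ∃ c : Fin N, (Literature.Geometry.DiscreteGeometry.bondGraph η y).Adj u c ∧ dist (y i) (y c) + 3 / 100 *
    Literature.Geometry.DiscreteGeometry.nearestDist y u < dist (y i) (y u) ∧ ((Literature.Geometry.DiscreteGeometry.bondGraph η y).Adj c t ∨ (Literature.Geometry.DiscreteGeometry.bondGraph η y).Adj c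
    k)) → (∀ η : ℝ, 0 < η → η ≤ 1 / 100 → ∀ (N : ℕ) (y : Fin N → EuclideanSpace ℝ (Fin 3)) (i : Fin N), 0 < Literature.Geometry.DiscreteGeometry.nearestDist y i → (∀ j : Fin N, dist (y i) (y j) ≤ 8 *
    Literature.Geometry.DiscreteGeometry.nearestDist y i → Literature.Geometry.DiscreteGeometry.IsChargeFree η y j) → (∀ j : Fin N, dist (y i) (y j) ≤ 8 *
    Literature.Geometry.DiscreteGeometry.nearestDist y i → ∃ (P : Finset (EuclideanSpace ℝ (Fin 3))) (A : EuclideanSpace ℝ (Fin 3) →ₗᵢ[ℝ] EuclideanSpace ℝ (Fin 3)) (m : EuclideanSpace ℝ (Fin 3) → Fin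
    N), (P = Literature.Geometry.DiscreteGeometry.fccKissingPattern ∨ P = Literature.Geometry.DiscreteGeometry.hcpKissingPattern) ∧ (∀ p ∈ P, (Literature.Geometry.DiscreteGeometry.bondGraph η y).Adj j
    (m p) ∧ dist (y (m p)) (y j + Literature.Geometry.DiscreteGeometry.nearestDist y j • A p) ≤ Literature.Geometry.DiscreteGeometry.nearestDist y j / 4) ∧ (∀ p ∈ P, ∀ q ∈ P, m p = m q → p = q) ∧ (∀ p
    ∈ P, ∀ q ∈ P, ((Literature.Geometry.DiscreteGeometry.bondGraph η y).Adj (m p) (m q) ↔ dist p q = 1)) ∧ (∀ l, (Literature.Geometry.DiscreteGeometry.bondGraph η y).Adj j l → ∃ p ∈ P, m p = l)) → ∃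
    (Pc : Fin N → Finset (EuclideanSpace ℝ (Fin 3))) (Ac : Fin N → EuclideanSpace ℝ (Fin 3) →ₗᵢ[ℝ] EuclideanSpace ℝ (Fin 3)) (mc : Fin N → EuclideanSpace ℝ (Fin 3) → Fin N), (∀ j : Fin N, dist (y i)
    (y j) ≤ 8 * Literature.Geometry.DiscreteGeometry.nearestDist y i → (Pc j = Literature.Geometry.DiscreteGeometry.fccKissingPattern ∨ Pc j = Literature.Geometry.DiscreteGeometry.hcpKissingPattern) ∧
    (∀ p ∈ Pc j, (Literature.Geometry.DiscreteGeometry.bondGraph η y).Adj j (mc j p) ∧ dist (y (mc j p)) (y j + Literature.Geometry.DiscreteGeometry.nearestDist y j • Ac j p) ≤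
    Literature.Geometry.DiscreteGeometry.nearestDist y j / 4) ∧ (∀ p ∈ Pc j, ∀ q ∈ Pc j, mc j p = mc j q → p = q) ∧ (∀ p ∈ Pc j, ∀ q ∈ Pc j, ((Literature.Geometry.DiscreteGeometry.bondGraph η y).Adj
    (mc j p) (mc j q) ↔ dist p q = 1)) ∧ (∀ l, (Literature.Geometry.DiscreteGeometry.bondGraph η y).Adj j l → ∃ p ∈ Pc j, mc j p = l)) ∧ (∀ j k : Fin N, dist (y i) (y j) ≤ 8 *
    Literature.Geometry.DiscreteGeometry.nearestDist y i → dist (y i) (y k) ≤ 8 * Literature.Geometry.DiscreteGeometry.nearestDist y i → (Literature.Geometry.DiscreteGeometry.bondGraph η y).Adj j k →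
    ∀ a b : Fin N, (Literature.Geometry.DiscreteGeometry.bondGraph η y).Adj j a → (Literature.Geometry.DiscreteGeometry.bondGraph η y).Adj j b → (Literature.Geometry.DiscreteGeometry.bondGraph η
    y).Adj k a → (Literature.Geometry.DiscreteGeometry.bondGraph η y).Adj k b → (Literature.Geometry.DiscreteGeometry.bondGraph η y).Adj a b → ∀ p₁ ∈ Pc j, ∀ p₂ ∈ Pc j, ∀ p₃ ∈ Pc j, mc j p₁ = k → mc j
    p₂ = a → mc j p₃ = b → ∀ q₁ ∈ Pc k, ∀ q₂ ∈ Pc k, ∀ q₃ ∈ Pc k, mc k q₁ = j → mc k q₂ = a → mc k q₃ = b → Matrix.det ![WithLp.ofLp p₁, WithLp.ofLp p₂, WithLp.ofLp p₃] = - Matrix.det ![WithLp.ofLp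
    q₁, WithLp.ofLp q₂, WithLp.ofLp q₃])) → (∀ η : ℝ, 0 < η → η ≤ 1 / 100 → ∀ (N : ℕ) (y : Fin N → EuclideanSpace ℝ (Fin 3)) (x : Fin N), 0 < Literature.Geometry.DiscreteGeometry.nearestDist y x → (∀
    j : Fin N, dist (y x) (y j) ≤ 5 / 2 * Literature.Geometry.DiscreteGeometry.nearestDist y x → Literature.Geometry.DiscreteGeometry.IsChargeFree η y j) → (∀ j : Fin N, dist (y x) (y j) ≤ 5 / 2 *
    Literature.Geometry.DiscreteGeometry.nearestDist y x → ∃ (P : Finset (EuclideanSpace ℝ (Fin 3))) (A : EuclideanSpace ℝ (Fin 3) →ₗᵢ[ℝ] EuclideanSpace ℝ (Fin 3)) (m : EuclideanSpace ℝ (Fin 3) → Fin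
    N), (P = Literature.Geometry.DiscreteGeometry.fccKissingPattern ∨ P = Literature.Geometry.DiscreteGeometry.hcpKissingPattern) ∧ (∀ p ∈ P, (Literature.Geometry.DiscreteGeometry.bondGraph η y).Adj j
    (m p) ∧ dist (y (m p)) (y j + Literature.Geometry.DiscreteGeometry.nearestDist y j • A p) ≤ Literature.Geometry.DiscreteGeometry.nearestDist y j / 4) ∧ (∀ p ∈ P, ∀ q ∈ P, m p = m q → p = q) ∧ (∀ p
    ∈ P, ∀ q ∈ P, ((Literature.Geometry.DiscreteGeometry.bondGraph η y).Adj (m p) (m q) ↔ dist p q = 1)) ∧ (∀ l, (Literature.Geometry.DiscreteGeometry.bondGraph η y).Adj j l → ∃ p ∈ P, m p = l)) → ∀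
    (A : EuclideanSpace ℝ (Fin 3) →ₗᵢ[ℝ] EuclideanSpace ℝ (Fin 3)) (m : EuclideanSpace ℝ (Fin 3) → Fin N), ((Literature.Geometry.DiscreteGeometry.fccKissingPattern =
    Literature.Geometry.DiscreteGeometry.fccKissingPattern ∨ Literature.Geometry.DiscreteGeometry.fccKissingPattern = Literature.Geometry.DiscreteGeometry.hcpKissingPattern) ∧ (∀ p ∈
    Literature.Geometry.DiscreteGeometry.fccKissingPattern, (Literature.Geometry.DiscreteGeometry.bondGraph η y).Adj x (m p) ∧ dist (y (m p)) (y x + Literature.Geometry.DiscreteGeometry.nearestDist y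
    x • A p) ≤ Literature.Geometry.DiscreteGeometry.nearestDist y x / 4) ∧ (∀ p ∈ Literature.Geometry.DiscreteGeometry.fccKissingPattern, ∀ q ∈ Literature.Geometry.DiscreteGeometry.fccKissingPattern,
    m p = m q → p = q) ∧ (∀ p ∈ Literature.Geometry.DiscreteGeometry.fccKissingPattern, ∀ q ∈ Literature.Geometry.DiscreteGeometry.fccKissingPattern, ((Literature.Geometry.DiscreteGeometry.bondGraph η
    y).Adj (m p) (m q) ↔ dist p q = 1)) ∧ (∀ l, (Literature.Geometry.DiscreteGeometry.bondGraph η y).Adj x l → ∃ p ∈ Literature.Geometry.DiscreteGeometry.fccKissingPattern, m p = l)) → ∀ u k t : Fin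
    N, (Literature.Geometry.DiscreteGeometry.bondGraph η y).Adj x u → (Literature.Geometry.DiscreteGeometry.bondGraph η y).Adj x k → ¬ (Literature.Geometry.DiscreteGeometry.bondGraph η y).Adj u k → u
    ≠ k → ¬ (Literature.Geometry.DiscreteGeometry.bondGraph η y).Adj x t → x ≠ t → (Literature.Geometry.DiscreteGeometry.bondGraph η y).Adj t u → (Literature.Geometry.DiscreteGeometry.bondGraph η
    y).Adj t k → ∃ c : Fin N, (Literature.Geometry.DiscreteGeometry.bondGraph η y).Adj x c ∧ (Literature.Geometry.DiscreteGeometry.bondGraph η y).Adj u c ∧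
    (Literature.Geometry.DiscreteGeometry.bondGraph η y).Adj k c ∧ (Literature.Geometry.DiscreteGeometry.bondGraph η y).Adj t c) → (∀ η : ℝ, 0 < η → η ≤ 1 / 100 → ∀ (N : ℕ) (y : Fin N → EuclideanSpace
    ℝ (Fin 3)) (x : Fin N), 0 < Literature.Geometry.DiscreteGeometry.nearestDist y x → (∀ j : Fin N, dist (y x) (y j) ≤ 5 / 2 * Literature.Geometry.DiscreteGeometry.nearestDist y x →
    Literature.Geometry.DiscreteGeometry.IsChargeFree η y j) → (∀ j : Fin N, dist (y x) (y j) ≤ 5 / 2 * Literature.Geometry.DiscreteGeometry.nearestDist y x → ∃ (P : Finset (EuclideanSpace ℝ (Fin 3)))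
    (A : EuclideanSpace ℝ (Fin 3) →ₗᵢ[ℝ] EuclideanSpace ℝ (Fin 3)) (m : EuclideanSpace ℝ (Fin 3) → Fin N), (P = Literature.Geometry.DiscreteGeometry.fccKissingPattern ∨ P =
    Literature.Geometry.DiscreteGeometry.hcpKissingPattern) ∧ (∀ p ∈ P, (Literature.Geometry.DiscreteGeometry.bondGraph η y).Adj j (m p) ∧ dist (y (m p)) (y j +
    Literature.Geometry.DiscreteGeometry.nearestDist y j • A p) ≤ Literature.Geometry.DiscreteGeometry.nearestDist y j / 4) ∧ (∀ p ∈ P, ∀ q ∈ P, m p = m q → p = q) ∧ (∀ p ∈ P, ∀ q ∈ P,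
    ((Literature.Geometry.DiscreteGeometry.bondGraph η y).Adj (m p) (m q) ↔ dist p q = 1)) ∧ (∀ l, (Literature.Geometry.DiscreteGeometry.bondGraph η y).Adj j l → ∃ p ∈ P, m p = l)) → ∀ (A :
    EuclideanSpace ℝ (Fin 3) →ₗᵢ[ℝ] EuclideanSpace ℝ (Fin 3)) (m : EuclideanSpace ℝ (Fin 3) → Fin N), ((Literature.Geometry.DiscreteGeometry.hcpKissingPattern =
    Literature.Geometry.DiscreteGeometry.fccKissingPattern ∨ Literature.Geometry.DiscreteGeometry.hcpKissingPattern = Literature.Geometry.DiscreteGeometry.hcpKissingPattern) ∧ (∀ p ∈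
    Literature.Geometry.DiscreteGeometry.hcpKissingPattern, (Literature.Geometry.DiscreteGeometry.bondGraph η y).Adj x (m p) ∧ dist (y (m p)) (y x + Literature.Geometry.DiscreteGeometry.nearestDist y
    x • A p) ≤ Literature.Geometry.DiscreteGeometry.nearestDist y x / 4) ∧ (∀ p ∈ Literature.Geometry.DiscreteGeometry.hcpKissingPattern, ∀ q ∈ Literature.Geometry.DiscreteGeometry.hcpKissingPattern,
    m p = m q → p = q) ∧ (∀ p ∈ Literature.Geometry.DiscreteGeometry.hcpKissingPattern, ∀ q ∈ Literature.Geometry.DiscreteGeometry.hcpKissingPattern, ((Literature.Geometry.DiscreteGeometry.bondGraph η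
    y).Adj (m p) (m q) ↔ dist p q = 1)) ∧ (∀ l, (Literature.Geometry.DiscreteGeometry.bondGraph η y).Adj x l → ∃ p ∈ Literature.Geometry.DiscreteGeometry.hcpKissingPattern, m p = l)) → ∀ u k t : Fin
    N, (Literature.Geometry.DiscreteGeometry.bondGraph η y).Adj x u → (Literature.Geometry.DiscreteGeometry.bondGraph η y).Adj x k → ¬ (Literature.Geometry.DiscreteGeometry.bondGraph η y).Adj u k → u
    ≠ k → ¬ (Literature.Geometry.DiscreteGeometry.bondGraph η y).Adj x t → x ≠ t → (Literature.Geometry.DiscreteGeometry.bondGraph η y).Adj t u → (Literature.Geometry.DiscreteGeometry.bondGraph η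
    y).Adj t k → ∃ c : Fin N, (Literature.Geometry.DiscreteGeometry.bondGraph η y).Adj x c ∧ (Literature.Geometry.DiscreteGeometry.bondGraph η y).Adj u c ∧
    (Literature.Geometry.DiscreteGeometry.bondGraph η y).Adj k c ∧ (Literature.Geometry.DiscreteGeometry.bondGraph η y).Adj t c) → ∀ η : ℝ, 0 < η → η ≤ 1 / 100 → ∀ (N : ℕ) (y : Fin N → EuclideanSpace
    ℝ (Fin 3)) (i : Fin N), 0 < Literature.Geometry.DiscreteGeometry.nearestDist y i → (∀ j : Fin N, dist (y i) (y j) ≤ 8 * Literature.Geometry.DiscreteGeometry.nearestDist y i →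
    Literature.Geometry.DiscreteGeometry.IsChargeFree η y j) → (∀ j : Fin N, dist (y i) (y j) ≤ 8 * Literature.Geometry.DiscreteGeometry.nearestDist y i → ∃ (P : Finset (EuclideanSpace ℝ (Fin 3))) (A
    : EuclideanSpace ℝ (Fin 3) →ₗᵢ[ℝ] EuclideanSpace ℝ (Fin 3)) (m : EuclideanSpace ℝ (Fin 3) → Fin N), (P = Literature.Geometry.DiscreteGeometry.fccKissingPattern ∨ P =
    Literature.Geometry.DiscreteGeometry.hcpKissingPattern) ∧ (∀ p ∈ P, (Literature.Geometry.DiscreteGeometry.bondGraph η y).Adj j (m p) ∧ dist (y (m p)) (y j +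
    Literature.Geometry.DiscreteGeometry.nearestDist y j • A p) ≤ Literature.Geometry.DiscreteGeometry.nearestDist y j / 4) ∧ (∀ p ∈ P, ∀ q ∈ P, m p = m q → p = q) ∧ (∀ p ∈ P, ∀ q ∈ P,
    ((Literature.Geometry.DiscreteGeometry.bondGraph η y).Adj (m p) (m q) ↔ dist p q = 1)) ∧ (∀ k, (Literature.Geometry.DiscreteGeometry.bondGraph η y).Adj j k → ∃ p ∈ P, m p = k)) → ∃ D : Fin N →
    EuclideanSpace ℝ (Fin 3), ∀ j : Fin N, (∃ w : (Literature.Geometry.DiscreteGeometry.bondGraph η y).Walk i j, w.length ≤ 5) → ∃ (P : Finset (EuclideanSpace ℝ (Fin 3))) (Q R : EuclideanSpace ℝ (Fin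
    3) →ₗᵢ[ℝ] EuclideanSpace ℝ (Fin 3)), (P = Literature.Geometry.DiscreteGeometry.fccKissingPattern ∨ P = Literature.Geometry.DiscreteGeometry.hcpKissingPattern) ∧ D '' {k |
    (Literature.Geometry.DiscreteGeometry.bondGraph η y).Adj j k} = (fun p => D j + Q p) '' (P : Set (EuclideanSpace ℝ (Fin 3))) ∧ (∀ k, (Literature.Geometry.DiscreteGeometry.bondGraph η y).Adj j k →
    ‖(y k - y j) - Literature.Geometry.DiscreteGeometry.nearestDist y j • R (D k - D j)‖ ≤ Literature.Geometry.DiscreteGeometry.nearestDist y j / 4) ∧ (∀ k k',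
    (Literature.Geometry.DiscreteGeometry.bondGraph η y).Adj j k → (Literature.Geometry.DiscreteGeometry.bondGraph η y).Adj j k' → ((Literature.Geometry.DiscreteGeometry.bondGraph η y).Adj k k' ↔ dist
    (D k) (D k') = 1)) := by
  intro H1R HO HXf HXh η hη0 hη1 N y i hνi hcf charts
  have hη : (0 : ℝ) ≤ η := hη0.le
  -- the gauge-fixed charts of `HO`
  obtain ⟨Pc, Ac, mc, hspec, hhand⟩ := HO η hη0 hη1 N y i hνi hcf charts
  -- the penalised radial potential
  obtain ⟨f, hf⟩ : ∃ f : Fin N → ℝ, ∀ v, f v = dist (y i) (y v) +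
      8 / 3 * max 0 (nearestDist y v - 53 / 50 * nearestDist y i) := ⟨_, fun v => rfl⟩
  have hfge : ∀ v, dist (y i) (y v) ≤ f v := fun v => by
    rw [hf]
    exact le_add_of_nonneg_right (mul_nonneg (by norm_num) (le_max_left _ _))
  have htier : ∀ v, dist (y i) (y v) + 8 / 3 * nearestDist y v ≤
      f v + 212 / 75 * nearestDist y i := by
    intro v
    rw [hf]
    have := le_max_right 0 (nearestDist y v - 53 / 50 * nearestDist y i)
    linarith
  have hd8 : ∀ v, f v ≤ 8 * nearestDist y i → dist (y i) (y v) ≤ 8 * nearestDist y i :=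
    fun v hv => (hfge v).trans hv
  have hR1 : ∀ v, f v ≤ 129 / 25 * nearestDist y i →
      dist (y i) (y v) + 8 / 3 * nearestDist y v ≤ 599 / 75 * nearestDist y i := by
    intro v hv
    have := htier v
    linarith
  refine develop_reduction η N y Pc Ac mc f (129 / 25 * nearestDist y i) (8 * nearestDist y i) i
    ?_ ?_ ?_ ?_ ?_ ?_ ?_
  · -- charts (with positive scale) wherever `f ≤ R₂`
    intro v hv
    have hd := hd8 v hv
    exact ⟨nearestDist y v, rfl, nearestDist_pos_of_isChargeFree (hcf v hd), hspec v hd⟩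
  · -- `hnbr`: a neighbour of `{f ≤ R₁}` has `f ≤ R₂`
    intro v w hwv hw
    have hνw := nearestDist_nonneg y w
    have hνv := nearestDist_nonneg y v
    have hdwv : dist (y w) (y v) ≤ 101 / 100 * nearestDist y w := developRest_dist_adj hη hη1 hwv
    have hsvw : nearestDist y v ≤ 101 / 100 * nearestDist y w :=
      developRest_scale_adj hη hη1 hwv.symm
    have htri := dist_triangle (y i) (y w) (y v)
    have hpen : max 0 (nearestDist y v - 53 / 50 * nearestDist y i) ≤
        max 0 (nearestDist y w - 53 / 50 * nearestDist y i) + 1 / 100 * nearestDist y w := by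
      refine max_le ?_ ?_
      · exact add_nonneg (le_max_left _ _) (mul_nonneg (by norm_num) hνw)
      · have := le_max_right 0 (nearestDist y w - 53 / 50 * nearestDist y i)
        linarith
    have hfv : f v ≤ f w + 311 / 300 * nearestDist y w := by
      rw [hf v, hf w]
      linarith
    have hw' := hR1 w hw
    by_cases hwi : w = i
    · subst hwi
      linarith
    · have hcore : nearestDist y w ≤ dist (y i) (y w) := by
        rw [dist_comm]
        exact nearestDist_le_dist y (fun h => hwi h.symm)
      linarith
  · -- `R₁ ≤ R₂`
    linarith
  · -- `HO`
    intro j k hj hk hjk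
    exact hhand j k (hd8 j hj) (hd8 k hk) hjk
  · -- `HX` from the two local no-merge lemmas
    intro x u k t hx hxu hxk hnuk hne hnxt hnext htu htk
    have hx8 : f x ≤ 8 * nearestDist y i := by linarith
    have hdx : dist (y i) (y x) ≤ 8 * nearestDist y i := hd8 x hx8
    have hνx : 0 < nearestDist y x := nearestDist_pos_of_isChargeFree (hcf x hdx)
    have hx' := hR1 x hx
    have hball : ∀ j, dist (y x) (y j) ≤ 5 / 2 * nearestDist y x →
        dist (y i) (y j) ≤ 8 * nearestDist y i := by
      intro j hj
      have := dist_triangle (y i) (y x) (y j)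
      have h0 := nearestDist_nonneg y x
      have h1 := nearestDist_nonneg y i
      linarith
    have hcfx : ∀ j, dist (y x) (y j) ≤ 5 / 2 * nearestDist y x → IsChargeFree η y j :=
      fun j hj => hcf j (hball j hj)
    obtain ⟨hP, C2, C3, C4, C5⟩ := hspec x hdx
    rcases hP with hP | hP
    · rw [hP] at C2 C3 C4 C5
      exact HXf η hη0 hη1 N y x hνx hcfx (fun j hj => charts j (hball j hj)) (Ac x) (mc x)
        ⟨Or.inl rfl, C2, C3, C4, C5⟩ u k t hxu hxk hnuk hne hnxt hnext htu htk
    · rw [hP] at C2 C3 C4 C5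
      exact HXh η hη0 hη1 N y x hνx hcfx (fun j hj => charts j (hball j hj)) (Ac x) (mc x)
        ⟨Or.inr rfl, C2, C3, C4, C5⟩ u k t hxu hxk hnuk hne hnxt hnext htu htk
  · -- `H1` from the metric ordered-caps lemma `H1R`
    intro u t k hu hut htk hnuk hne hku hut'
    have hνu := nearestDist_nonneg y u
    have hνi' := nearestDist_nonneg y i
    have s1 : nearestDist y u ≤ 101 / 100 * nearestDist y t := developRest_scale_adj hη hη1 hut
    have s2 : nearestDist y t ≤ 101 / 100 * nearestDist y k := developRest_scale_adj hη hη1 htk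
    have s4 : nearestDist y t ≤ 101 / 100 * nearestDist y u :=
      developRest_scale_adj hη hη1 hut.symm
    have hdu : dist (y i) (y u) + 8 / 3 * nearestDist y u ≤ 8 * nearestDist y i := by
      have := hR1 u hu
      linarith
    have hfk : f k ≤ f u := by
      rcases hku with h | ⟨h, -⟩
      · exact h.le
      · exact h.le
    have hft : f u ≤ f t := by
      rcases hut' with h | ⟨h, -⟩
      · exact h.le
      · exact h.le
    have pk := developRest_posPart_sub_le (nearestDist y u) (nearestDist y k)
      (53 / 50 * nearestDist y i)
    have pt := developRest_posPart_sub_le (nearestDist y t) (nearestDist y u)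
      (53 / 50 * nearestDist y i)
    have mk : max 0 (nearestDist y u - nearestDist y k) ≤ 33 / 1600 * nearestDist y u :=
      max_le (mul_nonneg (by norm_num) hνu) (by linarith)
    have mt : max 0 (nearestDist y t - nearestDist y u) ≤ 1 / 100 * nearestDist y u :=
      max_le (mul_nonneg (by norm_num) hνu) (by linarith)
    have hk' : dist (y i) (y k) ≤ dist (y i) (y u) + 11 / 200 * nearestDist y u := by
      rw [hf k, hf u] at hfk
      linarith
    have ht' : dist (y i) (y u) ≤ dist (y i) (y t) + 3 / 100 * nearestDist y u := by
      rw [hf u, hf t] at hft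
      linarith
    obtain ⟨c, huc, hdc, hc⟩ :=
      H1R η hη0 hη1 N y i hνi hcf charts u t k hdu hut htk hnuk hne hk' ht'
    refine ⟨c, huc, Or.inl ?_, hc⟩
    have s5 : nearestDist y c ≤ 101 / 100 * nearestDist y u :=
      developRest_scale_adj hη hη1 huc.symm
    have pc := developRest_posPart_sub_le (nearestDist y c) (nearestDist y u)
      (53 / 50 * nearestDist y i)
    have mc' : max 0 (nearestDist y c - nearestDist y u) ≤ 1 / 100 * nearestDist y u :=
      max_le (mul_nonneg (by norm_num) hνu) (by linarith)
    rw [hf c, hf u]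
    linarith
  · -- `Hcover`: the graph `5`-ball has `f = dist ≤ R₁`
    rintro j ⟨w, hw⟩
    obtain ⟨hd, hs⟩ := developRest_reach_five η hη hη1 N y i j w hw
    have h0 : max 0 (nearestDist y j - 53 / 50 * nearestDist y i) = 0 := max_eq_left (by linarith)
    rw [hf, h0]
    linarith

/-- **Registered sub-goal `develop_of_orderedCaps`** of the crux item: the CONCLUSION of the registered
stub `develop_rest` (exact development of the shadow crystal on the graph `5`-ball) from the metric
ordered-caps lemma `H1R` alone — `develop_rest_of_orderedCaps` with the landed `Theorems.develop_HO`,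
`Theorems.develop_HX_fcc`, `Theorems.develop_HX_hcp` plugged in.  Once `H1R` is proved as a theorem
`h`, the stub `develop_rest` is `fun _ _ _ => develop_of_orderedCaps h` (or
`develop_rest_of_orderedCaps h`). [folklore] -/
theorem develop_of_orderedCaps :
    (∀ η : ℝ, 0 < η → η ≤ 1 / 100 → ∀ (N : ℕ) (y : Fin N → EuclideanSpace ℝ (Fin 3)) (i : Fin N), 0 < nearestDist y i → (∀ j : Fin N, dist (y i) (y j) ≤ 8 * nearestDist y i → IsChargeFree η y j) → (∀
    j : Fin N, dist (y i) (y j) ≤ 8 * nearestDist y i → ∃ (P : Finset (EuclideanSpace ℝ (Fin 3))) (A : EuclideanSpace ℝ (Fin 3) →ₗᵢ[ℝ] EuclideanSpace ℝ (Fin 3)) (m : EuclideanSpace ℝ (Fin 3) → Fin N),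
    (P = fccKissingPattern ∨ P = hcpKissingPattern) ∧ (∀ p ∈ P, (bondGraph η y).Adj j (m p) ∧ dist (y (m p)) (y j + nearestDist y j • A p) ≤ nearestDist y j / 4) ∧ (∀ p ∈ P, ∀ q ∈ P, m p = m q → p =
    q) ∧ (∀ p ∈ P, ∀ q ∈ P, ((bondGraph η y).Adj (m p) (m q) ↔ dist p q = 1)) ∧ (∀ k, (bondGraph η y).Adj j k → ∃ p ∈ P, m p = k)) → ∀ u t k : Fin N, dist (y i) (y u) + 8 / 3 * nearestDist y u ≤ 8 *
    nearestDist y i → (bondGraph η y).Adj u t → (bondGraph η y).Adj t k → ¬ (bondGraph η y).Adj u k → u ≠ k → dist (y i) (y k) ≤ dist (y i) (y u) + 11 / 200 * nearestDist y u → dist (y i) (y u) ≤ dist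
    (y i) (y t) + 3 / 100 * nearestDist y u → ∃ c : Fin N, (bondGraph η y).Adj u c ∧ dist (y i) (y c) + 3 / 100 * nearestDist y u < dist (y i) (y u) ∧ ((bondGraph η y).Adj c t ∨ (bondGraph η y).Adj c
    k)) → ∀ η : ℝ, 0 < η → η ≤ 1 / 100 → ∀ (N : ℕ) (y : Fin N → EuclideanSpace ℝ (Fin 3)) (i : Fin N), 0 < nearestDist y i → (∀ j : Fin N, dist (y i) (y j) ≤ 8 * nearestDist y i → IsChargeFree η y j)
    → (∀ j : Fin N, dist (y i) (y j) ≤ 8 * nearestDist y i → ∃ (P : Finset (EuclideanSpace ℝ (Fin 3))) (A : EuclideanSpace ℝ (Fin 3) →ₗᵢ[ℝ] EuclideanSpace ℝ (Fin 3)) (m : EuclideanSpace ℝ (Fin 3) →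
    Fin N), (P = fccKissingPattern ∨ P = hcpKissingPattern) ∧ (∀ p ∈ P, (bondGraph η y).Adj j (m p) ∧ dist (y (m p)) (y j + nearestDist y j • A p) ≤ nearestDist y j / 4) ∧ (∀ p ∈ P, ∀ q ∈ P, m p = m q
    → p = q) ∧ (∀ p ∈ P, ∀ q ∈ P, ((bondGraph η y).Adj (m p) (m q) ↔ dist p q = 1)) ∧ (∀ k, (bondGraph η y).Adj j k → ∃ p ∈ P, m p = k)) → ∃ D : Fin N → EuclideanSpace ℝ (Fin 3), ∀ j : Fin N, (∃ w :
    (bondGraph η y).Walk i j, w.length ≤ 5) → ∃ (P : Finset (EuclideanSpace ℝ (Fin 3))) (Q R : EuclideanSpace ℝ (Fin 3) →ₗᵢ[ℝ] EuclideanSpace ℝ (Fin 3)), (P = fccKissingPattern ∨ P =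
    hcpKissingPattern) ∧ D '' {k | (bondGraph η y).Adj j k} = (fun p => D j + Q p) '' (P : Set (EuclideanSpace ℝ (Fin 3))) ∧ (∀ k, (bondGraph η y).Adj j k → ‖(y k - y j) - nearestDist y j • R (D k - D
    j)‖ ≤ nearestDist y j / 4) ∧ (∀ k k', (bondGraph η y).Adj j k → (bondGraph η y).Adj j k' → ((bondGraph η y).Adj k k' ↔ dist (D k) (D k') = 1)) := by
  intro H1R
  exact develop_rest_of_orderedCaps H1R develop_HO develop_HX_fcc develop_HX_hcp

end Summit.AtomisticToContinuum.Crystallization.Theorems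

end
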